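import Summits.Ventures.HSemireg.HomComplexSigmaGluing
import HarnessLib

/-!
# Trace cyclicity of `σ_q` on strictly perfect complexes: `σ_q^K(Q p ≫ ψ ≫ Q i⟦2⟧) = σ_q^{K₁}(Q(i ≫ p) ≫ ψ) = σ_q^{K₀}(ψ ≫ Q(i ≫ p)⟦2⟧)`

Cell `pub-hsemireg`, theory seat th-2 (LAW A of `theory/TH2-SIGMA-GLUING-LAWS.md`, CYCLIC form = the common parent of the two
landed σ-laws `HomComplex.sigmaC_conj` (`HomComplexSigmaConj.lean`, t-7: `i ≫ p = 𝟙`) and `HomComplex.sigmaC_gluing`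
(`HomComplexSigmaGluing.lean`, th-2: `i ≫ p = 0`), and the kernel form of the «filtered-lift precision» of HANDOFF-th-2 GEN 21 P.S.).
HONEST FRAMING: kernel plumbing on the target seat t-7's real carriers (`HomComplexSigma.lean`: `HomComplex.sigmaC`); NOT a door,
NOT a named fact, nothing about any variety or conjecture; nothing here says HC / HC_CM / HC_AV is proved.

MAIN RESULT (proved): `HomComplex.sigmaC_cyclic` — for chain maps `i : K₁• ⟶ K•`, `p : K• ⟶ K₀•` of cochain complexes of
`𝒪_X`-modules (NO relation between `i` and `p` assumed), `K₁•`, `K•` bounded in `[a, b]` with finite locally free terms, and any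
class `ψ : Q K₀• ⟶ (Q K₁•)⟦2⟧`, the class `x := Q(p) ≫ ψ ≫ Q(i)⟦2⟧ ∈ Ext²(K•, K•)` has
`σ_q^K(x) = σ_q^{K₁}(Q(i ≫ p) ≫ ψ)` for EVERY `q` — on paper ([BF03] Def. 4.1, Prop. 3.11, §4, proof of 4.2):
`σ_q(i ψ p) = Tr_K(At(K)^q ∘ i ψ p) = Tr_K((i ⊗ 1) At(K₁)^q ψ p) = Tr_{K₁}(At(K₁)^q ψ p i) = σ_q^{K₁}(ψ ∘ (p i))` (naturality of
the Atiyah class along `i`, cyclicity/dinaturality of the trace for the degree-`0` map `i`, so no Koszul sign).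
COROLLARIES (proved): `sigmaC_cyclic'` — the OTHER rotation `σ_q^K(x) = σ_q^{K₀}(ψ ≫ Q(i ≫ p)⟦2⟧)` (hypotheses on `K•`, `K₀•`;
it is `sigmaC_cyclic` for the pair `(p, 𝟙_{K₀})` re-bracketed); `sigmaC_retract` — for a RETRACT `r : K₁• ⟶ K•`, `s : K• ⟶ K₁•`,
`r ≫ s = 𝟙` (e.g. a direct summand `K• = K₁• ⊞ K′•`), `σ_q^K(Q s ≫ x₁ ≫ Q r⟦2⟧) = σ_q^{K₁}(x₁)`: the semiregularity value of a class
supported on a direct summand is computed on the summand; `sigmaC_comp_eq_sigmaC_comp` — `σ_q^K(Q p ≫ d) = σ_q^{K₀}(d ≫ Q p⟦2⟧)` for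
`p : K• ⟶ K₀•`, `d : Q K₀• ⟶ (Q K•)⟦2⟧`: two classes on `K•` that agree after restriction along every map INTO `K•` and differ by
`Q p ≫ d` have σ-values differing by `σ^{K₀}` of the class `d ≫ Q p⟦2⟧` ON `K₀•` — the kernel form of the GEN 21 P.S. precision
(«the pair `(x₁, x₀)` of a derived compatibility square does not determine `σ_q(x)`; the defect is `σ_q^{K₀}(e′ ∘ δ)`»);
the two landed laws re-derived from the cyclic one: `sigmaC_gluing'` (`i ≫ p = 0`) and `sigmaC_conj'` (`φ : K ≅ K'`); and `sigmaC_eq_add_of_total` —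
the GRADED formula for SPLIT presentations in full: `𝟙_K = π₁ ≫ ι₁ + π₂ ≫ ι₂` ⟹ `σ_q^K(x) = σ_q^{K₁}(Q ι₁ ≫ x ≫ Q π₁⟦2⟧) + σ_q^{K₂}(Q ι₂ ≫ x ≫ Q π₂⟦2⟧)`
for EVERY `x ∈ Ext²(K•, K•)` (off-diagonal blocks invisible, diagonal blocks additive).
INGREDIENTS (all landed; exactly those of `sigmaC_gluing`): `extMulAtiyahPower_gluing` (Step A, th-2 over gs-g4's
`complexAtiyahPowerFrom_naturality'`), `shiftedHomMap_mk₀_comp` / `shiftedHomMap_comp_mk₀` (gs-g4), `shiftedHomMap_premap` (t-7 over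
gs-g4), `supertraceH_dinatural` (t-7 over p3's `supertrace_dinatural`), `unit_comp_map_eq_unit_comp_premap` and `premap_comp_map` (t-7),
`sigmaC_zero` (t-7).  KERNEL NOTE: as in the two parent files every composition is spelled so that it is SYNTACTICALLY well-typed and
`set_option backward.isDefEq.respectTransparency false` crosses the `homFunctor`-vs-`map` seam.
[cite: BuchweitzFlenner2003, Def. 4.1, Prop. 3.11 and §4 (trace map; proof of Prop. 4.2)]
-/

noncomputable section

open CategoryTheory CategoryTheory.Limits AlgebraicGeometry Opposite

namespace Summit.Ventures.HSemireg

open Literature.AlgebraicGeometry.Modules Literature.AlgebraicGeometry.Motives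
open Summit.HodgeConjecture.HodgeConjecture.Theorems.PadicPridhamSemiregularity

namespace HomComplex

section Cyclic

universe w₁ u₁

variable {S : Type u₁} [CommRing S] (X : Over (Spec (CommRingCat.of S))) [HasDerivedCategory.{w₁} X.left.Modules]
  {K₁ K K₀ : CochainComplex X.left.Modules ℤ} (a b : ℤ)
  [K₁.IsStrictlyGE a] [K₁.IsStrictlyLE b] [K.IsStrictlyGE a] [K.IsStrictlyLE b]
  (hK₁ : ∀ n, IsFiniteLocallyFree (K₁.X n)) (hK : ∀ n, IsFiniteLocallyFree (K.X n))

set_option backward.isDefEq.respectTransparency false in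
omit [HasDerivedCategory X.left.Modules] in
/-- The head of the cyclic law, at the level of complexes: `unit_K ≫ 𝓗om•(K•, p) ≫ 𝓗om•(i, K₀•) = unit_{K₁} ≫ 𝓗om•(K₁•, i ≫ p)`
(unit naturality `unit_comp_map_eq_unit_comp_premap` and bifunctoriality `premap_comp_map`). [folklore] -/
theorem unit_comp_map_comp_premap (i : K₁ ⟶ K) (p : K ⟶ K₀) :
    unit X.left K a b ≫ (homFunctor X.left K).map p ≫ (premapNatTrans X.left i).app K₀ =
      unit X.left K₁ a b ≫ (homFunctor X.left K₁).map (i ≫ p) := by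
  have h1 : (premapNatTrans X.left i).app K ≫ (homFunctor X.left K₁).map p =
      (homFunctor X.left K).map p ≫ (premapNatTrans X.left i).app K₀ :=
    premap_comp_map X.left i p
  have h2 : unit X.left K₁ a b ≫ (homFunctor X.left K₁).map i = unit X.left K a b ≫ (premapNatTrans X.left i).app K :=
    unit_comp_map_eq_unit_comp_premap X.left K₁ a b K i
  rw [← h1, ← Category.assoc, ← h2, Category.assoc, ← Functor.map_comp]

set_option backward.isDefEq.respectTransparency false in
/-- The head of the cyclic law in the derived category: `Q(unit_K) ≫ Q(𝓗om•(K•, p)) ≫ Q(𝓗om•(i, K₀•)) = Q(unit_{K₁}) ≫ Q(𝓗om•(K₁•, i ≫ p))`.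
[folklore] -/
theorem unitQ_comp_map_comp_premap (i : K₁ ⟶ K) (p : K ⟶ K₀) :
    unitQ X K a b ≫ DerivedCategory.Q.map ((homFunctor X.left K).map p) ≫
      DerivedCategory.Q.map ((premapNatTrans X.left i).app K₀) =
      unitQ X K₁ a b ≫ DerivedCategory.Q.map ((homFunctor X.left K₁).map (i ≫ p)) := by
  unfold unitQ
  rw [← Functor.map_comp, ← Functor.map_comp, unit_comp_map_comp_premap X a b i p, Functor.map_comp]

set_option backward.isDefEq.respectTransparency false in
/-- **Trace cyclicity of `σ_q`** (LAW A of the cell's theory sheet `TH2-SIGMA-GLUING-LAWS.md`, cyclic form, on real carriers): for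
chain maps `i : K₁• ⟶ K•`, `p : K• ⟶ K₀•` (no relation assumed; `K₁•`, `K•` bounded in `[a, b]` with finite locally free terms) and any
`ψ : Q K₀• ⟶ (Q K₁•)⟦2⟧`, the class `x := Q(p) ≫ ψ ≫ Q(i)⟦2⟧ ∈ Ext²(K•, K•)` has `σ_q^K(x) = σ_q^{K₁}(Q(i ≫ p) ≫ ψ)` in
`Hom_D(Q 𝒪_X[0], (Q Ω^q[0])⟦q+2⟧)`.  Proof: Step A (`extMulAtiyahPower_gluing`: naturality of `ι · At^q` along `i`), functoriality
of `Φ_K` (`shiftedHomMap_mk₀_comp` / `shiftedHomMap_comp_mk₀`), dinaturality of the supertrace (`supertraceH_dinatural`), naturality of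
`Φ` in the first variable (`shiftedHomMap_premap`), then the head identity `unitQ_comp_map_comp_premap` and functoriality of `Φ_{K₁}`
again.  `sigmaC_conj` is the case `i ≫ p = 𝟙`, `sigmaC_gluing` the case `i ≫ p = 0`.
[cite: BuchweitzFlenner2003, Def. 4.1, Prop. 3.11 and §4 (trace map; proof of Prop. 4.2)] -/
theorem sigmaC_cyclic (i : K₁ ⟶ K) (p : K ⟶ K₀) (q : ℕ)
    (ψ : ShiftedHom (DerivedCategory.Q.obj K₀) (DerivedCategory.Q.obj K₁) (2 : ℤ)) :
    sigmaC X K a b hK q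
        ((ShiftedHom.mk₀ (0 : ℤ) rfl (DerivedCategory.Q.map p)).comp
          (ψ.comp (ShiftedHom.mk₀ (0 : ℤ) rfl (DerivedCategory.Q.map i)) (zero_add 2)) (add_zero 2)) =
      sigmaC X K₁ a b hK₁ q
        ((ShiftedHom.mk₀ (0 : ℤ) rfl (DerivedCategory.Q.map (i ≫ p))).comp ψ (add_zero 2)) := by
  -- Steps A and B: the middle factor of the left-hand side
  have hB : phiMulAtiyahPower X K a b hK q
      ((ShiftedHom.mk₀ (0 : ℤ) rfl (DerivedCategory.Q.map p)).comp
        (ψ.comp (ShiftedHom.mk₀ (0 : ℤ) rfl (DerivedCategory.Q.map i)) (zero_add 2)) (add_zero 2)) =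
      (ShiftedHom.mk₀ (0 : ℤ) rfl (DerivedCategory.Q.map ((homFunctor X.left K).map p))).comp
        ((shiftedHomMap (homFunctor X.left K) (homFunctor_isInvertedBy X K a b hK)
            (ψ.comp (complexAtiyahPowerFrom q K₁) (by ring))).comp
          (ShiftedHom.mk₀ (0 : ℤ) rfl (DerivedCategory.Q.map ((homFunctor X.left K).map (twistHodgeComplexMap X q i))))
          (zero_add _)) (add_zero _) := by
    unfold phiMulAtiyahPower
    rw [extMulAtiyahPower_gluing, shiftedHomMap_mk₀_comp, shiftedHomMap_comp_mk₀]
  -- the middle factor of the right-hand side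
  have hR : phiMulAtiyahPower X K₁ a b hK₁ q
      ((ShiftedHom.mk₀ (0 : ℤ) rfl (DerivedCategory.Q.map (i ≫ p))).comp ψ (add_zero 2)) =
      (ShiftedHom.mk₀ (0 : ℤ) rfl (DerivedCategory.Q.map ((homFunctor X.left K₁).map (i ≫ p)))).comp
        (shiftedHomMap (homFunctor X.left K₁) (homFunctor_isInvertedBy X K₁ a b hK₁)
            (ψ.comp (complexAtiyahPowerFrom q K₁) (by ring))) (add_zero _) := by
    unfold phiMulAtiyahPower
    rw [extMulAtiyahPower_eq_comp, shiftedHom_mk₀_comp_comp, shiftedHomMap_mk₀_comp]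
  -- the tail `Q(𝓗om•(K, i ⊗ 1)) ≫ Q(Tr•^H_K) = Q(𝓗om•(i, K₁ ⊗ Ω^q)) ≫ Q(Tr•^H_{K₁})`
  have hT : DerivedCategory.Q.map ((homFunctor X.left K).map (twistHodgeComplexMap X q i)) ≫
      DerivedCategory.Q.map (supertraceH X K hK q) =
      DerivedCategory.Q.map ((premapNatTrans X.left i).app (twistHodgeComplex X q K₁)) ≫
        DerivedCategory.Q.map (supertraceH X K₁ hK₁ q) := by
    rw [← Functor.map_comp, ← Functor.map_comp, supertraceH_dinatural X hK₁ hK q i]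
  have hL : sigmaC X K a b hK q
      ((ShiftedHom.mk₀ (0 : ℤ) rfl (DerivedCategory.Q.map p)).comp
        (ψ.comp (ShiftedHom.mk₀ (0 : ℤ) rfl (DerivedCategory.Q.map i)) (zero_add 2)) (add_zero 2)) =
      ((ShiftedHom.mk₀ (0 : ℤ) rfl
          (unitQ X K₁ a b ≫ DerivedCategory.Q.map ((homFunctor X.left K₁).map (i ≫ p)))).comp
        (shiftedHomMap (homFunctor X.left K₁) (homFunctor_isInvertedBy X K₁ a b hK₁)
            (ψ.comp (complexAtiyahPowerFrom q K₁) (rfl : (q : ℤ) + 2 = (q : ℤ) + 2))) (add_zero ((q : ℤ) + 2))).comp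
        (ShiftedHom.mk₀ (0 : ℤ) rfl (DerivedCategory.Q.map (supertraceH X K₁ hK₁ q)))
        (show (0 : ℤ) + ((q : ℤ) + 2) = ((q + 2 : ℕ) : ℤ) by omega) := by
    unfold sigmaC
    rw [hB, ShiftedHom.mk₀_comp_mk₀_assoc, ← shiftedHom_mk₀_comp_comp, shiftedHom_comp_mk₀_comp_mk₀_cast, hT,
      ← shiftedHom_comp_mk₀_comp_mk₀_cast, shiftedHom_mk₀_comp_comp, shiftedHomMap_premap X i a b hK₁ hK,
      ShiftedHom.mk₀_comp_mk₀_assoc, Category.assoc, unitQ_comp_map_comp_premap X a b i p]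
  have hR' : sigmaC X K₁ a b hK₁ q
      ((ShiftedHom.mk₀ (0 : ℤ) rfl (DerivedCategory.Q.map (i ≫ p))).comp ψ (add_zero 2)) =
      ((ShiftedHom.mk₀ (0 : ℤ) rfl
          (unitQ X K₁ a b ≫ DerivedCategory.Q.map ((homFunctor X.left K₁).map (i ≫ p)))).comp
        (shiftedHomMap (homFunctor X.left K₁) (homFunctor_isInvertedBy X K₁ a b hK₁)
            (ψ.comp (complexAtiyahPowerFrom q K₁) (rfl : (q : ℤ) + 2 = (q : ℤ) + 2))) (add_zero ((q : ℤ) + 2))).comp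
        (ShiftedHom.mk₀ (0 : ℤ) rfl (DerivedCategory.Q.map (supertraceH X K₁ hK₁ q)))
        (show (0 : ℤ) + ((q : ℤ) + 2) = ((q + 2 : ℕ) : ℤ) by omega) := by
    unfold sigmaC
    rw [hR, ShiftedHom.mk₀_comp_mk₀_assoc]
  exact hL.trans hR'.symm

end Cyclic

/-! ## Corollaries: the other rotation, retracts / direct summands, the re-gluing defect, and the two landed laws re-derived -/

section Corollaries

universe w₁ u₁

variable {S : Type u₁} [CommRing S] (X : Over (Spec (CommRingCat.of S))) [HasDerivedCategory.{w₁} X.left.Modules]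
  {K₁ K K₀ : CochainComplex X.left.Modules ℤ} (a b : ℤ)

set_option backward.isDefEq.respectTransparency false in
/-- **The other rotation**: for `i : K₁• ⟶ K•`, `p : K• ⟶ K₀•` (`K•`, `K₀•` bounded in `[a, b]` with finite locally free terms) and
`ψ : Q K₀• ⟶ (Q K₁•)⟦2⟧`, `σ_q^K(Q p ≫ ψ ≫ Q i⟦2⟧) = σ_q^{K₀}(ψ ≫ Q(i ≫ p)⟦2⟧)` — on paper `Tr_K(At^q i ψ p) = Tr_{K₀}((p ⊗ 1) At^q i ψ)
= Tr_{K₀}(At(K₀)^q (p i) ψ)`.  Proof: `sigmaC_cyclic` for the pair `(i′, p′) := (p, 𝟙_{K₀})` and the class `ψ′ := ψ ≫ Q i⟦2⟧`, re-bracketed.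
[cite: BuchweitzFlenner2003, Def. 4.1, Prop. 3.11 and §4 (trace map)] -/
theorem sigmaC_cyclic' [K.IsStrictlyGE a] [K.IsStrictlyLE b] [K₀.IsStrictlyGE a] [K₀.IsStrictlyLE b]
    (hK : ∀ n, IsFiniteLocallyFree (K.X n)) (hK₀ : ∀ n, IsFiniteLocallyFree (K₀.X n))
    (i : K₁ ⟶ K) (p : K ⟶ K₀) (q : ℕ)
    (ψ : ShiftedHom (DerivedCategory.Q.obj K₀) (DerivedCategory.Q.obj K₁) (2 : ℤ)) :
    sigmaC X K a b hK q
        ((ShiftedHom.mk₀ (0 : ℤ) rfl (DerivedCategory.Q.map p)).comp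
          (ψ.comp (ShiftedHom.mk₀ (0 : ℤ) rfl (DerivedCategory.Q.map i)) (zero_add 2)) (add_zero 2)) =
      sigmaC X K₀ a b hK₀ q
        ((ψ.comp (ShiftedHom.mk₀ (0 : ℤ) rfl (DerivedCategory.Q.map i)) (zero_add 2)).comp
          (ShiftedHom.mk₀ (0 : ℤ) rfl (DerivedCategory.Q.map p)) (zero_add 2)) := by
  have h := sigmaC_cyclic X a b hK hK₀ p (𝟙 K₀) q
    (ψ.comp (ShiftedHom.mk₀ (0 : ℤ) rfl (DerivedCategory.Q.map i)) (zero_add 2))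
  rw [Category.comp_id, CategoryTheory.Functor.map_id, ShiftedHom.mk₀_id_comp] at h
  exact h.symm

set_option backward.isDefEq.respectTransparency false in
/-- **`σ_q` of a class supported on a RETRACT / direct summand is computed on the summand**: for `r : K₁• ⟶ K•`, `s : K• ⟶ K₁•`
with `r ≫ s = 𝟙_{K₁}` (e.g. the inclusion and projection of a summand of `K• = K₁• ⊞ K′•`; `K₁•`, `K•` bounded in `[a, b]` with finite
locally free terms) and `x₁ ∈ Ext²(K₁•, K₁•)`, `σ_q^K(Q s ≫ x₁ ≫ Q r⟦2⟧) = σ_q^{K₁}(x₁)`.  With `sigmaC_add` this gives the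
block-DIAGONAL additivity `σ_q^{K₁ ⊞ K′}(x₁ ⊕ x′) = σ_q^{K₁}(x₁) + σ_q^{K′}(x′)` (apply twice and add).
[cite: BuchweitzFlenner2003, Def. 4.1 and §4 (trace map)] -/
theorem sigmaC_retract [K₁.IsStrictlyGE a] [K₁.IsStrictlyLE b] [K.IsStrictlyGE a] [K.IsStrictlyLE b]
    (hK₁ : ∀ n, IsFiniteLocallyFree (K₁.X n)) (hK : ∀ n, IsFiniteLocallyFree (K.X n))
    (r : K₁ ⟶ K) (s : K ⟶ K₁) (hrs : r ≫ s = 𝟙 K₁) (q : ℕ)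
    (x₁ : ShiftedHom (DerivedCategory.Q.obj K₁) (DerivedCategory.Q.obj K₁) (2 : ℤ)) :
    sigmaC X K a b hK q
        ((ShiftedHom.mk₀ (0 : ℤ) rfl (DerivedCategory.Q.map s)).comp
          (x₁.comp (ShiftedHom.mk₀ (0 : ℤ) rfl (DerivedCategory.Q.map r)) (zero_add 2)) (add_zero 2)) =
      sigmaC X K₁ a b hK₁ q x₁ := by
  rw [sigmaC_cyclic X a b hK₁ hK r s q x₁, hrs, CategoryTheory.Functor.map_id, ShiftedHom.mk₀_id_comp]

set_option backward.isDefEq.respectTransparency false in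
/-- **The re-gluing defect is seen on `K₀•`** (kernel form of the GEN 21 P.S. precision of `theory/HANDOFF-th-2.md`): for
`p : K• ⟶ K₀•` (`K•`, `K₀•` bounded in `[a, b]` with finite locally free terms) and ANY `d : Q K₀• ⟶ (Q K•)⟦2⟧`,
`σ_q^K(Q p ≫ d) = σ_q^{K₀}(d ≫ Q p⟦2⟧)`.  So if two classes `x, x′ ∈ Ext²(K•, K•)` differ by `Q p ≫ d` (they then agree after
composition with EVERY map into `K•` killed by `p`, e.g. with `Q i` for a triangle `K₁ → K → K₀`), their semiregularity values differ
by `σ_q^{K₀}` of the class `d ≫ Q p⟦2⟧` on `K₀•` — non-zero in general (abelian surface example of the P.S.).  Proof: `sigmaC_cyclic'`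
at `i := 𝟙_K`. [cite: BuchweitzFlenner2003, Def. 4.1 and §4 (trace map)] -/
theorem sigmaC_comp_eq_sigmaC_comp [K.IsStrictlyGE a] [K.IsStrictlyLE b] [K₀.IsStrictlyGE a] [K₀.IsStrictlyLE b]
    (hK : ∀ n, IsFiniteLocallyFree (K.X n)) (hK₀ : ∀ n, IsFiniteLocallyFree (K₀.X n))
    (p : K ⟶ K₀) (q : ℕ) (d : ShiftedHom (DerivedCategory.Q.obj K₀) (DerivedCategory.Q.obj K) (2 : ℤ)) :
    sigmaC X K a b hK q ((ShiftedHom.mk₀ (0 : ℤ) rfl (DerivedCategory.Q.map p)).comp d (add_zero 2)) =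
      sigmaC X K₀ a b hK₀ q (d.comp (ShiftedHom.mk₀ (0 : ℤ) rfl (DerivedCategory.Q.map p)) (zero_add 2)) := by
  have h := sigmaC_cyclic' X a b hK hK₀ (𝟙 K) p q d
  rw [CategoryTheory.Functor.map_id, ShiftedHom.comp_mk₀_id] at h
  exact h

set_option backward.isDefEq.respectTransparency false in
/-- `sigmaC_gluing` RE-DERIVED from the cyclic law: `i ≫ p = 0` ⟹ `σ_q^K(Q p ≫ ψ ≫ Q i⟦2⟧) = σ_q^{K₁}(0 ≫ ψ) = 0`
(`sigmaC_zero`). [cite: BuchweitzFlenner2003, Def. 4.1, Prop. 3.11 and §4 (trace map)] -/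
theorem sigmaC_gluing' [K₁.IsStrictlyGE a] [K₁.IsStrictlyLE b] [K.IsStrictlyGE a] [K.IsStrictlyLE b]
    (hK₁ : ∀ n, IsFiniteLocallyFree (K₁.X n)) (hK : ∀ n, IsFiniteLocallyFree (K.X n))
    (i : K₁ ⟶ K) (p : K ⟶ K₀) (hip : i ≫ p = 0) (q : ℕ)
    (ψ : ShiftedHom (DerivedCategory.Q.obj K₀) (DerivedCategory.Q.obj K₁) (2 : ℤ)) :
    sigmaC X K a b hK q
        ((ShiftedHom.mk₀ (0 : ℤ) rfl (DerivedCategory.Q.map p)).comp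
          (ψ.comp (ShiftedHom.mk₀ (0 : ℤ) rfl (DerivedCategory.Q.map i)) (zero_add 2)) (add_zero 2)) = 0 := by
  rw [sigmaC_cyclic X a b hK₁ hK i p q ψ, hip, Functor.map_zero, ShiftedHom.mk₀_zero, ShiftedHom.zero_comp, sigmaC_zero]

set_option backward.isDefEq.respectTransparency false in
/-- `sigmaC_conj` RE-DERIVED from the cyclic law: for `φ : K• ≅ K'•`, `σ_q^{K'}(Q φ⁻¹ ≫ x ≫ Q φ⟦2⟧) = σ_q^K(Q(φ ≫ φ⁻¹) ≫ x) = σ_q^K(x)`.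
[cite: BuchweitzFlenner2003, Def. 4.1] -/
theorem sigmaC_conj' {K' : CochainComplex X.left.Modules ℤ} [K.IsStrictlyGE a] [K.IsStrictlyLE b] [K'.IsStrictlyGE a]
    [K'.IsStrictlyLE b] (hK : ∀ n, IsFiniteLocallyFree (K.X n)) (hK' : ∀ n, IsFiniteLocallyFree (K'.X n))
    (φ : K ≅ K') (q : ℕ) (x : ShiftedHom (DerivedCategory.Q.obj K) (DerivedCategory.Q.obj K) (2 : ℤ)) :
    sigmaC X K' a b hK' q
        ((ShiftedHom.mk₀ (0 : ℤ) rfl (DerivedCategory.Q.map φ.inv)).comp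
          (x.comp (ShiftedHom.mk₀ (0 : ℤ) rfl (DerivedCategory.Q.map φ.hom)) (zero_add 2)) (add_zero 2)) =
      sigmaC X K a b hK q x :=
  sigmaC_retract X a b hK hK' φ.hom φ.inv φ.hom_inv_id q x

set_option backward.isDefEq.respectTransparency false in
/-- **`σ_q` on a complex presented as a SUM is the sum over the summands of `σ_q` of the diagonal blocks** (LAW A's GRADED
formula for SPLIT filtrations, all of it): if `𝟙_K = π₁ ≫ ι₁ + π₂ ≫ ι₂` for chain maps `π_a : K• ⟶ K_a•`, `ι_a : K_a• ⟶ K•` (e.g. the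
projections / injections of a biproduct `K• = K₁• ⊞ K₂•`; NO other biproduct identity is needed; `K•`, `K₁•`, `K₂•` bounded in `[a, b]`
with finite locally free terms), then for EVERY `x ∈ Ext²(K•, K•)`:
`σ_q^K(x) = σ_q^{K₁}(Q ι₁ ≫ x ≫ Q π₁⟦2⟧) + σ_q^{K₂}(Q ι₂ ≫ x ≫ Q π₂⟦2⟧)` — the off-diagonal blocks of `x` are invisible and the
diagonal blocks count additively (p1's PARALLEL-PIECE law / the block-diagonal supertrace, kernel form).  Proof: `x = Q(π₁ ≫ ι₁ + π₂ ≫ ι₂) ≫ x`,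
additivity (`sigmaC_add`), and the re-gluing law `sigmaC_comp_eq_sigmaC_comp` on each term. [cite: BuchweitzFlenner2003, Def. 4.1 and §4 (trace map)] -/
theorem sigmaC_eq_add_of_total {K₂ : CochainComplex X.left.Modules ℤ} [K₁.IsStrictlyGE a] [K₁.IsStrictlyLE b]
    [K.IsStrictlyGE a] [K.IsStrictlyLE b] [K₂.IsStrictlyGE a] [K₂.IsStrictlyLE b]
    (hK₁ : ∀ n, IsFiniteLocallyFree (K₁.X n)) (hK : ∀ n, IsFiniteLocallyFree (K.X n))
    (hK₂ : ∀ n, IsFiniteLocallyFree (K₂.X n))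
    (ι₁ : K₁ ⟶ K) (π₁ : K ⟶ K₁) (ι₂ : K₂ ⟶ K) (π₂ : K ⟶ K₂) (htot : π₁ ≫ ι₁ + π₂ ≫ ι₂ = 𝟙 K) (q : ℕ)
    (x : ShiftedHom (DerivedCategory.Q.obj K) (DerivedCategory.Q.obj K) (2 : ℤ)) :
    sigmaC X K a b hK q x =
      sigmaC X K₁ a b hK₁ q
          ((ShiftedHom.mk₀ (0 : ℤ) rfl (DerivedCategory.Q.map ι₁)).comp
            (x.comp (ShiftedHom.mk₀ (0 : ℤ) rfl (DerivedCategory.Q.map π₁)) (zero_add 2)) (add_zero 2)) +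
        sigmaC X K₂ a b hK₂ q
          ((ShiftedHom.mk₀ (0 : ℤ) rfl (DerivedCategory.Q.map ι₂)).comp
            (x.comp (ShiftedHom.mk₀ (0 : ℤ) rfl (DerivedCategory.Q.map π₂)) (zero_add 2)) (add_zero 2)) := by
  -- `x = Q(𝟙) ≫ x = Q π₁ ≫ (Q ι₁ ≫ x) + Q π₂ ≫ (Q ι₂ ≫ x)`
  have hx : x = (ShiftedHom.mk₀ (0 : ℤ) rfl (DerivedCategory.Q.map π₁)).comp
        ((ShiftedHom.mk₀ (0 : ℤ) rfl (DerivedCategory.Q.map ι₁)).comp x (add_zero 2)) (add_zero 2) +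
      (ShiftedHom.mk₀ (0 : ℤ) rfl (DerivedCategory.Q.map π₂)).comp
        ((ShiftedHom.mk₀ (0 : ℤ) rfl (DerivedCategory.Q.map ι₂)).comp x (add_zero 2)) (add_zero 2) := by
    rw [ShiftedHom.mk₀_comp_mk₀_assoc, ShiftedHom.mk₀_comp_mk₀_assoc, ← Functor.map_comp, ← Functor.map_comp,
      ← ShiftedHom.add_comp, ← ShiftedHom.mk₀_add, ← Functor.map_add, htot, CategoryTheory.Functor.map_id,
      ShiftedHom.mk₀_id_comp]
  conv_lhs => rw [hx]
  rw [sigmaC_add, sigmaC_comp_eq_sigmaC_comp X a b hK hK₁ π₁ q, sigmaC_comp_eq_sigmaC_comp X a b hK hK₂ π₂ q,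
    shiftedHom_mk₀_comp_comp, shiftedHom_mk₀_comp_comp]

end Corollaries

end HomComplex

end Summit.Ventures.HSemireg

end
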